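import Summits.CriticalPhenomena.PercolationContinuityZ3.Theorems.PercNearOneGluingNoHeavyLowerTailSahiE3ExchangeCross
import Mathlib.Tactic.Linarith
import Mathlib.Tactic.Ring
import Mathlib.Tactic.Positivity
import HarnessLib
import HarnessLib.Audit

/-!
# `NoHeavyLowerTail` (crux stmt-CriticalPhenomena-4575), Sahi programme P4: the 2×2 exchange lemma in the PURE class — MODULAR (component) packings

Support file (cell `prim-l12`, seat P4, generation 28; `--supports stmt-CriticalPhenomena-4575`).  No named facts, no sorries;
standard axioms; def-free.

Context (HOME prim-l12-p4/FROM-prim-l12-p4-gen28-*.md; predecessors `…SahiE3ExchangeCross`, `…SahiE3ExchangePure`,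
`…SahiE3ExchangePureCut`, `…SahiE3ExchangeJoin`).  Harris block `(B, w, V)`, `a(X) = w(X∩V)`, `need(X,Y) = x·a(Y) + y·a(X) − v·x·y`,
PURE configuration `K ⊇ L`, `L' ⊇ K'`, supplies `S₁ = KK'V`, `S₂ = LL'V`, crossing cell `Ξ = (K∖L)∩(L'∖K')∩V`, certificate
`R ≥ 0` on `V`.  The packings used so far to bound the supply `R(S₁) + R(S₂)` from below are the SAME-FOOTPRINT packing
`(K,K'),(L,L')` and the CHAINS (footprints `Σ = S₁∪S₂`, `Δ = S₁∩S₂`).  This file adds the MODULAR family: for up-sets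
`M₁, M₂` with `M₁ ∪ M₂ = K`, `M₁ ∩ M₂ = L` and `N₁, N₂` with `N₁ ∪ N₂ = L'`, `N₁ ∩ N₂ = K'` (so `1_{M₁}+1_{M₂} = 1_K+1_L` and
`1_{N₁}+1_{N₂} = 1_{K'}+1_{L'}`; `Mᵢ∖L` runs over the unions of comparability components of `K∖L`), the two pairs `(M₁,N₁)`,
`(M₂,N₂)` form an admissible packing of `1_{S₁}+1_{S₂}` EXACTLY when no crossing point is matched, i.e.
`(M₁∖M₂)∩(N₁∖N₂)∩V = ∅ = (M₂∖M₁)∩(N₂∖N₁)∩V` (`packing_modular`: then `R(M₁N₁V) + R(M₂N₂V) = R(S₁) + R(S₂)` for every `R`), and the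
exchange expression is bounded below by its value with the supply replaced by `need(M₁,N₁) + need(M₂,N₂)`
(`exchange_pure_modular_bound`); by bilinearity the loss against the (inadmissible) cross packing is
`need(M₁∖M₂, N₂∖N₁) + need(M₂∖M₁, N₁∖N₂)` versus `need(K∖L, L'∖K')` for the same-footprint packing `M₁ = K, M₂ = L, N₁ = K', N₂ = L'`.
Generation 28 (HOME memo): at a single crossing point the exact LP optimum is such a modular packing in the standard hard examples
(`K = x₀∨x₁ ⊋ L = x₀x₁`: `M₁ = x₀`, `M₂ = x₁`), but modular packings alone do not close the lemma (chains are needed too).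
-/

namespace Summit.CriticalPhenomena.PercolationContinuityZ3.Theorems.SahiE3ExchangeModular

open Finset SahiE3DimerPacking SahiE3ExchangeCross
open scoped BigOperators

variable {B : Type*} [DecidableEq B]

/-- **Modular packing.**  `R ≥ 0` on `V`; `M₁ ∪ M₂ = K`, `M₁ ∩ M₂ = L`, `N₁ ∪ N₂ = L'`, `N₁ ∩ N₂ = K'`; and no slot point lies in
`(M₁∖M₂)∩(N₁∖N₂)` or in `(M₂∖M₁)∩(N₂∖N₁)` (no crossing point is matched).  Then
`R(M₁∩N₁∩V) + R(M₂∩N₂∩V) = R(K∩K'∩V) + R(L∩L'∩V)` for ANY `R` (pointwise `1_{M₁N₁} + 1_{M₂N₂} = 1_{KK'} + 1_{LL'}` on `V`: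
the modular packing is exact away from matched crossing points). [this work] -/
theorem packing_modular (R : B → ℝ) (V K L K' L' M₁ M₂ N₁ N₂ : Finset B)
    (hM : M₁ ∪ M₂ = K) (hM' : M₁ ∩ M₂ = L) (hN : N₁ ∪ N₂ = L') (hN' : N₁ ∩ N₂ = K')
    (hmis₁ : ((M₁ \ M₂) ∩ (N₁ \ N₂)) ∩ V = ∅) (hmis₂ : ((M₂ \ M₁) ∩ (N₂ \ N₁)) ∩ V = ∅) :
    ∑ b ∈ (M₁ ∩ N₁) ∩ V, R b + ∑ b ∈ (M₂ ∩ N₂) ∩ V, R b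
      = ∑ b ∈ (K ∩ K') ∩ V, R b + ∑ b ∈ (L ∩ L') ∩ V, R b := by
  subst hM hM' hN hN'
  have h₁ : ∀ b ∈ V, ¬ (b ∈ M₁ ∧ b ∉ M₂ ∧ b ∈ N₁ ∧ b ∉ N₂) := by
    intro b hb h
    have : b ∈ ((M₁ \ M₂) ∩ (N₁ \ N₂)) ∩ V := by
      simp only [Finset.mem_inter, Finset.mem_sdiff]; exact ⟨⟨⟨h.1, h.2.1⟩, ⟨h.2.2.1, h.2.2.2⟩⟩, hb⟩
    rw [hmis₁] at this; exact absurd this (Finset.notMem_empty b)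
  have h₂ : ∀ b ∈ V, ¬ (b ∈ M₂ ∧ b ∉ M₁ ∧ b ∈ N₂ ∧ b ∉ N₁) := by
    intro b hb h
    have : b ∈ ((M₂ \ M₁) ∩ (N₂ \ N₁)) ∩ V := by
      simp only [Finset.mem_inter, Finset.mem_sdiff]; exact ⟨⟨⟨h.1, h.2.1⟩, ⟨h.2.2.1, h.2.2.2⟩⟩, hb⟩
    rw [hmis₂] at this; exact absurd this (Finset.notMem_empty b)
  simp only [sum_inter_eq_sum_ite, ← Finset.sum_add_distrib]
  refine Finset.sum_congr rfl fun b hb => ?_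
  have n₁ := h₁ b hb
  have n₂ := h₂ b hb
  simp only [Finset.mem_inter, Finset.mem_union]
  by_cases hm1 : b ∈ M₁ <;> by_cases hm2 : b ∈ M₂ <;> by_cases hn1 : b ∈ N₁ <;> by_cases hn2 : b ∈ N₂ <;>
    simp [hm1, hm2, hn1, hn2] at n₁ n₂ ⊢

/-- **Exchange bound from a modular packing (pure class).**  `w` of mass `1` (any sign pattern is irrelevant here), slot `V`,
`L ⊆ K`, `K' ⊆ L'` presented through a modular decomposition `M₁ ∪ M₂ = K`, `M₁ ∩ M₂ = L`, `N₁ ∪ N₂ = L'`, `N₁ ∩ N₂ = K'` with no matched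
crossing point, any weight `R` satisfying the pair inequality at `(M₁,N₁)` and at `(M₂,N₂)` (no sign condition on `R` is needed:
the modular packing is exact).  Then the pure-class exchange
expression `Φ(R)` is at least its value with the supply `R(S₁) + R(S₂)` replaced by `need(M₁,N₁) + need(M₂,N₂)`. [this work] -/
theorem exchange_pure_modular_bound (w R : B → ℝ)
    (V K L K' L' M₁ M₂ N₁ N₂ : Finset B)
    (hM : M₁ ∪ M₂ = K) (hM' : M₁ ∩ M₂ = L) (hN : N₁ ∪ N₂ = L') (hN' : N₁ ∩ N₂ = K')
    (hmis₁ : ((M₁ \ M₂) ∩ (N₁ \ N₂)) ∩ V = ∅) (hmis₂ : ((M₂ \ M₁) ∩ (N₂ \ N₁)) ∩ V = ∅)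
    (hpair₁ : (∑ b ∈ M₁, w b) * (∑ b ∈ N₁ ∩ V, w b) + (∑ b ∈ N₁, w b) * (∑ b ∈ M₁ ∩ V, w b)
        - (∑ b ∈ V, w b) * (∑ b ∈ M₁, w b) * (∑ b ∈ N₁, w b) ≤ ∑ b ∈ (M₁ ∩ N₁) ∩ V, R b)
    (hpair₂ : (∑ b ∈ M₂, w b) * (∑ b ∈ N₂ ∩ V, w b) + (∑ b ∈ N₂, w b) * (∑ b ∈ M₂ ∩ V, w b)
        - (∑ b ∈ V, w b) * (∑ b ∈ M₂, w b) * (∑ b ∈ N₂, w b) ≤ ∑ b ∈ (M₂ ∩ N₂) ∩ V, R b) :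
    (∑ b ∈ (K ∩ L') ∩ V, w b) + (∑ b ∈ (L ∩ K') ∩ V, w b)
        - (∑ b ∈ K, w b) * (∑ b ∈ K' ∩ V, w b) - (∑ b ∈ L', w b) * (∑ b ∈ L ∩ V, w b)
        + ((∑ b ∈ M₁, w b) * (∑ b ∈ N₁ ∩ V, w b) + (∑ b ∈ N₁, w b) * (∑ b ∈ M₁ ∩ V, w b)
            - (∑ b ∈ V, w b) * (∑ b ∈ M₁, w b) * (∑ b ∈ N₁, w b))
        + ((∑ b ∈ M₂, w b) * (∑ b ∈ N₂ ∩ V, w b) + (∑ b ∈ N₂, w b) * (∑ b ∈ M₂ ∩ V, w b)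
            - (∑ b ∈ V, w b) * (∑ b ∈ M₂, w b) * (∑ b ∈ N₂, w b))
        - ((∑ b ∈ K, w b) * (∑ b ∈ L' ∩ V, w b) + (∑ b ∈ L', w b) * (∑ b ∈ K ∩ V, w b)
            - (∑ b ∈ V, w b) * (∑ b ∈ K, w b) * (∑ b ∈ L', w b))
        - ((∑ b ∈ L, w b) * (∑ b ∈ K' ∩ V, w b) + (∑ b ∈ K', w b) * (∑ b ∈ L ∩ V, w b)
            - (∑ b ∈ V, w b) * (∑ b ∈ L, w b) * (∑ b ∈ K', w b))
        + (1 - ∑ b ∈ V, w b) * (((∑ b ∈ K ∩ L', w b) - (∑ b ∈ K, w b) * (∑ b ∈ L', w b))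
            + ((∑ b ∈ K, w b) - ∑ b ∈ L, w b) * ((∑ b ∈ L', w b) - ∑ b ∈ K', w b))
      ≤ (∑ b ∈ (K ∩ L') ∩ V, w b) + (∑ b ∈ (L ∩ K') ∩ V, w b)
        - (∑ b ∈ K, w b) * (∑ b ∈ K' ∩ V, w b) - (∑ b ∈ L', w b) * (∑ b ∈ L ∩ V, w b)
        + (∑ b ∈ (K ∩ K') ∩ V, R b) + (∑ b ∈ (L ∩ L') ∩ V, R b)
        - ((∑ b ∈ K, w b) * (∑ b ∈ L' ∩ V, w b) + (∑ b ∈ L', w b) * (∑ b ∈ K ∩ V, w b)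
            - (∑ b ∈ V, w b) * (∑ b ∈ K, w b) * (∑ b ∈ L', w b))
        - ((∑ b ∈ L, w b) * (∑ b ∈ K' ∩ V, w b) + (∑ b ∈ K', w b) * (∑ b ∈ L ∩ V, w b)
            - (∑ b ∈ V, w b) * (∑ b ∈ L, w b) * (∑ b ∈ K', w b))
        + (1 - ∑ b ∈ V, w b) * (((∑ b ∈ K ∩ L', w b) - (∑ b ∈ K, w b) * (∑ b ∈ L', w b))
            + ((∑ b ∈ K, w b) - ∑ b ∈ L, w b) * ((∑ b ∈ L', w b) - ∑ b ∈ K', w b)) := by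
  have hpack := packing_modular R V K L K' L' M₁ M₂ N₁ N₂ hM hM' hN hN' hmis₁ hmis₂
  linarith

/-- **Modularity of the masses.**  `M₁ ∪ M₂ = K`, `M₁ ∩ M₂ = L` ⇒ `f(M₁) + f(M₂) = f(K) + f(L)` and the same for the traces on `V`.
(Used to rewrite the modular bound in terms of `K, L` and the differences `Mᵢ∖L`.) [folklore] -/
theorem sum_modular_pair (f : B → ℝ) (V K L M₁ M₂ : Finset B) (hM : M₁ ∪ M₂ = K) (hM' : M₁ ∩ M₂ = L) :
    ∑ b ∈ M₁, f b + ∑ b ∈ M₂, f b = ∑ b ∈ K, f b + ∑ b ∈ L, f b ∧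
      ∑ b ∈ M₁ ∩ V, f b + ∑ b ∈ M₂ ∩ V, f b = ∑ b ∈ K ∩ V, f b + ∑ b ∈ L ∩ V, f b := by
  subst hM hM'
  refine ⟨?_, ?_⟩
  · rw [Finset.sum_union_inter]
  · have : (M₁ ∪ M₂) ∩ V = M₁ ∩ V ∪ M₂ ∩ V := Finset.union_inter_distrib_right _ _ _
    have h2 : M₁ ∩ M₂ ∩ V = (M₁ ∩ V) ∩ (M₂ ∩ V) := by
      ext b; simp only [Finset.mem_inter]; tauto
    rw [this, h2, Finset.sum_union_inter]

end Summit.CriticalPhenomena.PercolationContinuityZ3.Theorems.SahiE3ExchangeModular
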